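import Summits.BirchSwinnertonDyer.Rank1Residual.X2.RankOne
import Summits.BirchSwinnertonDyer.Rank1Residual.X11b.BDPRouteDescent
import Summits.BirchSwinnertonDyer.Rank1Residual.X11b.TwistTransport
import Literature.NumberTheory.EllipticCurves.Wuthrich2014.ShaBoundProofs
import Literature.NumberTheory.EllipticCurves.RootNumberEvenAnalyticRankProofs
import Literature.NumberTheory.EllipticCurves.Rank1Residual.GVParityTwistTransportProofs
import Literature.NumberTheory.EllipticCurves.PastenHeightBoundsLemma68Proofs
import Literature.NumberTheory.DiophantineGeometry.AbcWave0GranvilleStarkTheorem2Proofs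
import HarnessLib

/-!
# Class X2, rank `1` (sub-cell X2c): the typed input OVER `K` — the Heegner-index identity at a
# multiplicative Eisenstein prime — and the exact descent to `BSD(E,p)` (cell `b2b-bsdres`, unit `b2b-bsdres-eisenstein-p2`, gen 2)

HONEST FRAMING (run/shared/lean/b2b/bsd-rank1-residual/, verbatim in every file): the goal of the
cell is to DELETE the COMBINATION-SHAPED residual classes of the Birch–Swinnerton-Dyer formula for
ALL analytic-rank `≤ 1` elliptic curves over `ℚ` — "full BSD formula for every rank `≤ 1` curve in
class `C`" assembled STRICTLY from published theorems — so that the rank-`≤ 1` remainder becomes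
exactly the CONSTRUCTION-SHAPED classes, which are TYPED (missing-input `Prop`s), NOT attempted.
This is not "finishing BSD". Research routes; no claim beyond stated classes. Sub-cell X2c
(`X2.CellC W p := ord_{s=1} L(E,s) = 1 ∧ p ≠ 2 ∧ E[p] reducible ∧ p ‖ N`; 373 ‖ 705 census pairs
below 10⁴ ‖ 2·10⁴) is and stays CONSTRUCTION-SHAPED; its label does not change.

`X2/RankOne.lean` (gen 1, p200339) typed the missing input of X2c as the display OVER `ℚ`
(`X2.RankOneDisplay`, CGLS 2022 (5.7) with "multiplicative" for "good"), i.e. AFTER Gross–Zagier,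
the Artin formalism, the period relation and the descent of `Ш` and of the torsion from `K` to `ℚ` —
all PROVED in the tree (`X11b/BDPRouteDescent.lean`, p199961: `X11b.bsdp_of_indexIdentityAt`, exact
at every odd `p`, torsion included). This file moves the typed input UP the chain, to the statement
OVER `K` that an anticyclotomic main conjecture + control theorem + BDP formula would deliver:

* `X2.HeegnerIndexIdentity` — TYPED MISSING INPUT (a `Prop`, nothing asserted, announced by nobody
  at `p ‖ N` for reducible `E[p]`): for a CellC pair, an admissible `K` (`d_K` odd `< −4`, every
  `ℓ ∣ N` split, `L(E^{d_K},1) ≠ 0`), a parametrisation datum with Manin constant prime to `p` and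
  its Heegner point `P_K`: `Ш(E/K)` finite ⟹ `2·ord_p ∏_ℓ c_ℓ(E/ℚ) + ord_p #Ш(E/K) = 2·ord_p
  [E(K) : ℤ·P_K]` — LITERALLY the predicate `X11b.IndexIdentityAt` of the irreducible twin class X11b
  (`X11b/BDPRoute.lean`), the `p`-part of Gross–Zagier's Conj. V.(2.2) / Castella 2018 (5.3); CGLS
  2022 Thm. 5.3.1 proves it at a GOOD Eisenstein prime. In print toward it at `p ‖ N`: (a) the
  anticyclotomic main conjecture — Keller–Yin arXiv:2402.12781v2 Thm. 5.0.4 (PREPRINT, in `Λ^ur`);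
  (b) an anticyclotomic CONTROL theorem at a multiplicative prime allowing `E(K_v)[p] ≠ 0`:
  ANNOUNCED — Keller–Yin §7 Thm. 7.0.6 / Prop. 7.0.5 (PREPRINT) are stated in the abstract setting
  of JSW 2017 §3 minus (irred_K), (HT), whose hypothesis (sst) ("V semistable at w ∣ p") INCLUDES
  the non-crystalline = multiplicative case (JSW §3.3.3 case (ii)); the E-specific local index at a
  multiplicative `𝔭` is Castella 2018 §2, proof of Thm. 2.3 ((eq:calcul), (eq:tam-p): `ε_p = 0`,
  `[E(K_𝔭):E₀(K_𝔭)]_p = c_w^{(p)}`), PUBLISHED (printed under §2.1's irreducible standing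
  hypothesis, not used in those lines) — the assembled statement is printed nowhere as such; (c)
  the BDP formula at `p ‖ N` — Castella, J. Inst. Math. Jussieu 17 (2018) Thm. 2.10–2.11 (PUB; §2
  there has no irreducibility; standing `p ≥ 5`, split), used as Castella 2018 Thm. 3.2 with
  `ε_p = 0`. (a)+(b)+(c) is assembled NOWHERE; (a), (b) rest on a preprint; at `p = 3` (c) is not
  in print either.
* `bsdp_of_cellC_of_indexIdentityAt` — POINTWISE: a CellC pair with explicit Heegner data, the
  identity over `K`, a globally minimal model of the twist with the two decidable transport values
  and the twist's rank-`0` print shape ⟹ `BSD(E,p)`: `X11b.bsdp_of_indexIdentityAt` with `w_K = 2`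
  (`torsionOrder_eq_two_of_discr_lt`) — valid at EVERY odd `p`, in particular `p = 3`.
* `bsdp_of_cellC_of_not_gvPar_of_indexIdentityAt` — the partner SUPPLIED for `¬GVPar W p` (ψ even;
  567 of 705 pairs): the twist is a rank-`0` X2 pair WITH (GV), closed in `X2/RankZero.lean` (the GV
  fact at `p ‖ N` carries the referee flag `GV00-mult-asserted`).
* `bsdp_of_isIsogenous_of_bsdp` — Cassels: `p ∤ c` concerns ONE curve of the isogeny class (the
  `X₀(N)`-optimal curve has `p ∤ c` at an odd `p ‖ N`, Mazur 1978 / Agashe–Ribet–Stein 2006 Thm. 2.6;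
  at an Eisenstein prime the other members may be `p`-isogenous only), and `BSD(·,p)` transports.
* `CellC.of_isIsogenous` — X2c is an isogeny-class condition (for the Manin-constant remark).
* CLASS LEVEL: `X2/RankOneHeegnerClass.lean` (published facts as binders, a per-pair Manin condition,
  one transport package, the typed input; ψ even needs nothing else, ψ odd needs sub-cell X2b).

Net effect: no label moves; the typed input of X2c is now the over-`K` identity SHARED with X11b
(same predicate) — the two rank-one multiplicative classes differ only in the engine that would
supply it — and Gross–Zagier / descent / torsion are no longer inside the typed input.

References: [CastellaEtAl2021] Thm. 5.3.1; [KellerYin2024] (PRE) Thm. 5.0.4, §7, App. B, p. 4;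
[Castella2018] (5.2)–(5.3), Thm. 3.2; [Castella2018Exceptional]; [JetchevSkinnerWan2017] §7.4;
[GrossZagier1986] V.§2; [GrossLMS1991] Conj. (2.2); [AgasheRibetStein2006] Thm. 2.6; [MilneADT2006]
Thm. I.7.3; [Miller2011LMS] Def. 1.1.
-/
set_option autoImplicit false

noncomputable section

open scoped Classical MatrixGroups ModularForm

open CongruenceSubgroup WeierstrassCurve NumberField Literature.NumberTheory.EllipticCurves
  Literature.NumberTheory.EllipticCurves.ModularForms Literature.NumberTheory.QuadraticFields
  Literature.NumberTheory.EllipticCurves.Rank1Residual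
  Literature.NumberTheory.EllipticCurves.Rank1Residual.Typed
  Literature.NumberTheory.EllipticCurves.GreenbergVatsal2000
  Literature.NumberTheory.EllipticCurves.Wuthrich2014
  Literature.NumberTheory.EllipticCurves.SteinWuthrich2013

namespace Summit.BirchSwinnertonDyer.Rank1Residual.X2

/-! ### The typed input over `K` -/

/-- **TYPED MISSING INPUT of sub-cell X2c — the Heegner-index identity over `K` at a multiplicative
Eisenstein prime.** For `W/ℚ` globally minimal elliptic of conductor `N`, `p ≠ 2` of multiplicative
reduction with `E[p]` reducible and `ord_{s=1} L(E,s) = 1`; an imaginary quadratic `K` with `d_K` odd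
`< −4` satisfying the Heegner hypothesis for `N` (so `p` splits) with `L(E^{d_K},1) ≠ 0`; a modular
parametrisation datum `Dt` of level `N` with Manin constant prime to `p` and its Heegner point
`P ∈ E(K)`: if `Ш(E/K)` is finite then `2·ord_p ∏_ℓ c_ℓ(E/ℚ) + ord_p #Ш(E/K) = 2·ord_p [E(K):ℤ·P]`
(`X11b.IndexIdentityAt`). At a GOOD Eisenstein prime this is Castella–Grossi–Lee–Skinner 2022
Thm. 5.3.1 (anticyclotomic main conjecture + control + BDP); at `p ‖ N` the main conjecture is
Keller–Yin Thm. 5.0.4 (PREPRINT), the control theorem allowing `p`-torsion is Keller–Yin Thm. 7.0.6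
(PREPRINT; JSW's (sst) setting, which includes multiplicative `p`) with Castella 2018's local index
at `𝔭` (PUB), the BDP formula is Castella JIMJ 17 (2018) Thm. 2.11 (PUB, `p ≥ 5`). A `Prop`; nothing
asserted; the assembled identity is NOT an announced theorem. [cite: CastellaEtAl2021, Thm. 5.3.1 (shape only; nothing asserted)]
[cite: Castella2018, (5.3) (p. 12) (shape only)] -/
def HeegnerIndexIdentity : Prop :=
  ∀ (W : WeierstrassCurve ℚ) [W.IsElliptic] [W.IsGloballyMinimal] (p : ℕ) [Fact p.Prime]
    (N : ℕ) [NeZero N] (K : Type) [Field K] [NumberField K]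
    (Dt : ModularParametrizationData W N) (H : HeegnerDatum N (NumberField.discr K)) (ι : K →+* ℂ)
    (P : (W.baseChange K).toAffine.Point),
    p ≠ 2 → W.HasMultiplicativeReductionAtPrime p → ¬ W.HasIrreducibleModPGaloisRep p →
    W.analyticRank = 1 → W.conductorNorm ℤ = N → IsImaginaryQuadratic K →
    Odd (NumberField.discr K) → NumberField.discr K < -4 → SatisfiesHeegnerHypothesis N K →
    (W.quadraticTwist (NumberField.discr K : ℚ)).entireLFunction 1 ≠ 0 →
    WeierstrassCurve.Affine.Point.map ι.toRatAlgHom P = heegnerPointComplex Dt H →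
    ¬ (p : ℤ) ∣ Dt.c → Finite (W.baseChange K).sha → X11b.IndexIdentityAt W p K P

/-! ### `w_K = 2` -/

/-- For an imaginary quadratic `K` with `d_K < -4`, no odd prime divides `w_K = #𝓞_K^× = 2`.
[cite: GrossZagier1986, I.§1 (u = 1 unless d = −3, −4)] -/
theorem not_dvd_unitsTorsionOrder_of_discr_lt {K : Type} [Field K] [NumberField K]
    (hK : IsImaginaryQuadratic K) (hd : NumberField.discr K < -4) {p : ℕ} (hp : p.Prime)
    (hp2 : p ≠ 2) : ¬ p ∣ Units.torsionOrder K := by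
  rw [Literature.NumberTheory.DiophantineGeometry.torsionOrder_eq_two_of_discr_lt hK.1 hd]
  intro h
  exact hp2 ((Nat.prime_dvd_prime_iff_eq hp Nat.prime_two).mp h)

/-! ### Pointwise: X2c ⇐ the identity over `K` + the twist's rank-zero `p`-part -/

/-- **X2c ⇒ `BSD(E,p)` at a pair, from the Heegner-index identity over `K`, the rank-zero `p`-part
of the twist, and published facts** — `X11b.bsdp_of_indexIdentityAt` (the exact descent `K → ℚ` of
JSW 2017 §7.4.1 / Castella 2018 §5 / Gross–Zagier V.§2, PROVED in the tree, torsion included) read on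
a CellC pair: `K` imaginary quadratic with `d_K < −4` (so `w_K = 2`, prime to the odd `p`), Heegner
hypothesis for the level `N` of the datum `Dt` (`p ∤ c(Dt)`), `P` its Heegner point, `L(E^{d_K},1) ≠ 0`,
a globally minimal `Wd = Cd • E^{(d_K)}` with the two decidable values `htam`, `hu`, and
`PPartRankZero Wd p`. Binders (PUBLISHED): `hGZ`, `hKo`, `hGZK`, `hmod`. Valid at every odd `p`.
[cite: JetchevSkinnerWan2017, §7.4.1 (eq:gz for K′), p. 30] [cite: Miller2011LMS, Def. 1.1] -/
theorem bsdp_of_cellC_of_indexIdentityAt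
    (W : WeierstrassCurve ℚ) [W.IsElliptic] [W.IsGloballyMinimal] (p : ℕ) [Fact p.Prime]
    (N : ℕ) [NeZero N] (K : Type) [Field K] [NumberField K]
    (Dt : ModularParametrizationData W N) (H : HeegnerDatum N (NumberField.discr K)) (ι : K →+* ℂ)
    (P : (W.baseChange K).toAffine.Point)
    -- the published inputs (named facts of the tree)
    (hGZ : gross_zagier N W K) (hKo : kolyvagin N W K)
    (hGZK : rank_eq_analyticRank_of_analyticRank_le_one) (hmod : hasEntireLFunction_rat)
    -- the pair and the Heegner data
    (hc : CellC W p) (hK : IsImaginaryQuadratic K) (hd4 : NumberField.discr K < -4)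
    (hHN : SatisfiesHeegnerHypothesis N K)
    (hP : WeierstrassCurve.Affine.Point.map ι.toRatAlgHom P = heegnerPointComplex Dt H)
    (hcM : ¬ (p : ℤ) ∣ Dt.c)
    (hLt : (W.quadraticTwist (NumberField.discr K : ℚ)).entireLFunction 1 ≠ 0)
    -- a globally minimal model of the twist, its rank-zero print shape, the two decidable values
    (Wd : WeierstrassCurve ℚ) [Wd.IsElliptic] [Wd.IsGloballyMinimal] (Cd : VariableChange ℚ)
    (hWd : Cd • W.quadraticTwist (NumberField.discr K : ℚ) = Wd)
    (htw : PPartRankZero Wd p)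
    (htam : padicValNat p Wd.tamagawaProduct = padicValNat p W.tamagawaProduct)
    (hu : padicValRat p (Cd.u : ℚ) = 0)
    -- the identity over `K`
    (hid : Finite (W.baseChange K).sha → X11b.IndexIdentityAt W p K P) : BSDp W p := by
  have hp : p.Prime := Fact.out
  obtain ⟨hr, hp2, -, -⟩ := hc
  have hμ : ¬ p ∣ Units.torsionOrder K := not_dvd_unitsTorsionOrder_of_discr_lt hK hd4 hp hp2
  exact X11b.bsdp_of_indexIdentityAt W p N K Dt H ι P hGZ hKo hGZK hmod hK hHN hP hp2 hcM hμ hr hLt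
    Wd Cd hWd htw htam hu hid

/-- **X2c ∧ ¬(GV) ⇒ `BSD(E,p)` at a pair, from the identity over `K` ALONE** (published facts and the
two decidable transport values otherwise): when `¬ GVPar W p` (ψ even) the twist `E^{d_K}` — a rank-`0`
X2 pair at the same prime, `p` being split in `K` — HAS the Greenberg–Vatsal parity, so its print shape
comes from the closed sub-cell X2a (`pPartRankZero_twist_of_not_gvPar`; the GV fact at `p ‖ N` carries
the referee flag `GV00-mult-asserted`). Extra binders: the X2a facts and `p` split in `K` (`hsplit`).
[cite: CastellaEtAl2021, Thm. 5.3.1 (last paragraph of the proof)] [cite: Miller2011LMS, Def. 1.1] -/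
theorem bsdp_of_cellC_of_not_gvPar_of_indexIdentityAt
    (hGV : lambdaMu_multiplicative_of_gvPar) (hWu : thm16_charIdeal_dvd_multiplicative_of_reducible)
    (hJs : thm61_splitMultiplicative) (hJn : thm61_nonsplitMultiplicative)
    (hHs : exists_isSplitMultCanonical) (hHn : exists_isMultCanonical)
    (hpar : nonempty_modularParametrizationData)
    (hGS : ∀ (W : WeierstrassCurve ℚ) [W.IsElliptic] [W.IsGloballyMinimal] (p : ℕ) [Fact p.Prime],
      greenberg_stevens (W := W) (p := p))
    (W : WeierstrassCurve ℚ) [W.IsElliptic] [W.IsGloballyMinimal] (p : ℕ) [Fact p.Prime]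
    (N : ℕ) [NeZero N] (K : Type) [Field K] [NumberField K]
    (Dt : ModularParametrizationData W N) (H : HeegnerDatum N (NumberField.discr K)) (ι : K →+* ℂ)
    (P : (W.baseChange K).toAffine.Point)
    (hGZ : gross_zagier N W K) (hKo : kolyvagin N W K)
    (hGZK : rank_eq_analyticRank_of_analyticRank_le_one) (hmod : hasEntireLFunction_rat)
    (hc : CellC W p) (hnot : ¬ GVPar W p) (hK : IsImaginaryQuadratic K)
    (hd4 : NumberField.discr K < -4) (hHN : SatisfiesHeegnerHypothesis N K)
    (hsplit : SatisfiesHeegnerHypothesis p K)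
    (hP : WeierstrassCurve.Affine.Point.map ι.toRatAlgHom P = heegnerPointComplex Dt H)
    (hcM : ¬ (p : ℤ) ∣ Dt.c)
    (hLt : (W.quadraticTwist (NumberField.discr K : ℚ)).entireLFunction 1 ≠ 0)
    (Wd : WeierstrassCurve ℚ) [Wd.IsElliptic] [Wd.IsGloballyMinimal] (Cd : VariableChange ℚ)
    (hWd : Cd • W.quadraticTwist (NumberField.discr K : ℚ) = Wd)
    (htam : padicValNat p Wd.tamagawaProduct = padicValNat p W.tamagawaProduct)
    (hu : padicValRat p (Cd.u : ℚ) = 0)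
    (hid : Finite (W.baseChange K).sha → X11b.IndexIdentityAt W p K P) : BSDp W p := by
  have hD0 : (NumberField.discr K : ℚ) ≠ 0 := by exact_mod_cast NumberField.discr_ne_zero K
  haveI hEt : (W.quadraticTwist (NumberField.discr K : ℚ)).IsElliptic :=
    W.isElliptic_quadraticTwist hD0
  -- the twist has analytic rank `0`
  have hLt' : (W.quadraticTwist (NumberField.discr K : ℚ)).entireLFunction = Wd.entireLFunction := by
    rw [← hWd, entireLFunction_smul]
  have hLd1 : Wd.entireLFunction 1 ≠ 0 := by rw [← hLt']; exact hLt
  have hrd : Wd.analyticRank = 0 := (Wd.analyticRank_eq_zero_iff_holds (hmod Wd)).2 hLd1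
  -- `∃ C, C • Wd = W^{(d_K)}` (the inverse change of variables)
  have hWd' : ∃ C : VariableChange ℚ, C • Wd = W.quadraticTwist (NumberField.discr K : ℚ) :=
    ⟨Cd⁻¹, by rw [← hWd, inv_smul_smul]⟩
  -- the partner lies in X2a
  have htw : PPartRankZero Wd p :=
    pPartRankZero_twist_of_not_gvPar hGV hWu hJs hJn hHs hHn hGZK hmod hpar hGS W p hc.2 hnot K hK
      hsplit Wd hWd' hrd
  exact bsdp_of_cellC_of_indexIdentityAt W p N K Dt H ι P hGZ hKo hGZK hmod hc hK hd4 hHN hP hcM hLt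
    Wd Cd hWd htw htam hu hid

/-! ### Cassels: transport along the isogeny class (the optimal-curve remark) -/

/-- **`BSD(·,p)` passes along a `ℚ`-isogeny at analytic rank `≤ 1`** (Cassels, `hCassels`; `Ш` finite
by GZK, `hGZK`; leading coefficient `≠ 0` by modularity, `hmod`). Use: `p ∤ c` above concerns ONE curve
of the class (the `X₀(N)`-optimal one has `p ∤ c` at an odd `p ‖ N`, Mazur 1978 / ARS 2006 Thm. 2.6).
[cite: MilneADT2006, Thm. I.7.3] [cite: AgasheRibetStein2006, Thm. 2.6] -/
theorem bsdp_of_isIsogenous_of_bsdp (hCassels : bsdRHS_eq_of_isIsogenous)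
    (hGZK : rank_eq_analyticRank_of_analyticRank_le_one) (hmod : hasEntireLFunction_rat)
    (W W' : WeierstrassCurve ℚ) [W.IsElliptic] [W'.IsElliptic] [W.IsGloballyMinimal]
    [W'.IsGloballyMinimal] (hiso : IsIsogenous W W') (p : ℕ) [Fact p.Prime]
    (hr : W.analyticRank ≤ 1) (h : BSDp W p) : BSDp W' p := by
  obtain ⟨-, hfin⟩ := hGZK W hr
  have hlead : W.leadingLCoeff ≠ 0 := WeierstrassCurve.leadingLCoeff_ne_zero_holds (hmod W)
  exact Wuthrich2014.bsdp_of_isIsogenous hCassels hiso.symm_of_charZero hfin hlead h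

/-! ### X2c is an isogeny-class condition -/

/-- **Sub-cell X2c is a property of the `ℚ`-isogeny class** (globally minimal models): the analytic
rank (equal `L`-functions), reducibility of `E[p]` and multiplicative reduction at `p` (conductor
exponent `f_p = 1`, Serre–Tate / Silverman VII.7.2) are isogeny invariants. With
`bsdp_of_isIsogenous_of_bsdp` this moves the Manin-constant condition to any curve of the class.
[cite: SilvermanAEC2009, Cor. VII.7.2 and Ex. 5.4] -/
theorem CellC.of_isIsogenous {W W' : WeierstrassCurve ℚ} [W.IsElliptic] [W'.IsElliptic]
    [W.IsGloballyMinimal] [W'.IsGloballyMinimal] {p : ℕ} [Fact p.Prime] (h : IsIsogenous W W')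
    (hc : CellC W p) : CellC W' p := by
  have hp : p.Prime := Fact.out
  obtain ⟨hr, hp2, hred, hmult⟩ := hc
  refine ⟨?_, hp2, not_hasIrreducibleModPGaloisRep_of_isIsogenous h hred, ?_⟩
  · rw [← analyticRank_eq_of_isIsogenous' h]; exact hr
  · -- multiplicative reduction along the isogeny, through the place-indexed predicate
    have hb := WeierstrassCurve.hasMultiplicativeReductionAtPrime_iff_hasMultiplicativeReductionAt_holds
    have h1 : W.HasMultiplicativeReductionAt
        ((Rat.HeightOneSpectrum.primesEquiv (R := ℤ)).symm ⟨p, hp⟩) := (hb W ⟨p, hp⟩).mp hmult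
    exact (hb W' ⟨p, hp⟩).mpr (hasMultiplicativeReductionAt_of_isIsogenous h _ h1)

end Summit.BirchSwinnertonDyer.Rank1Residual.X2

end
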